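import Mathlib.Analysis.CStarAlgebra.Matrix
import Mathlib.Analysis.InnerProductSpace.PiL2
import Mathlib.MeasureTheory.Constructions.Pi
import Mathlib.MeasureTheory.Measure.Support
import Mathlib.MeasureTheory.Integral.Bochner.Basic
import Mathlib.Analysis.SpecialFunctions.Log.Basic
import HarnessLib

/-!
# The one-dimensional Anderson model: transfer matrices, the Lyapunov exponent, Fürstenberg positivity and the uniform large-deviation estimates of Bucaj–Damanik–Fillman–Gerbuz–VandenBoom–Wang–Zhang

Products of the i.i.d. `SL(2,ℝ)` transfer matrices `M^E(α) = [[E - α, -1],[1, 0]]` of the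
discrete Schrödinger / Anderson eigenvalue equation `ψ(n+1) + ψ(n-1) + ω_n ψ(n) = E ψ(n)` with
i.i.d. single-site potentials `ω_n ~ μ̃`.  This file DEFINES the objects and VENDORS, as named
facts, the classical inputs of one-dimensional localisation theory in the complete and
self-contained form printed in

* V. Bucaj, D. Damanik, J. Fillman, V. Gerbuz, T. VandenBoom, F. Wang, Z. Zhang, *Localization for
  the one-dimensional Anderson model via positivity and large deviations for the Lyapunov
  exponent*, Trans. Amer. Math. Soc. **372** (2019) 3619–3667, arXiv:1706.06135 — §2
  (setting, Def. 2.2, Thm 2.3 = Fürstenberg positivity for the Anderson model, Thm 2.6 =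
  continuity of `L`), §3 (Thm 3.1 = uniform LDT for `‖M_n^E‖`, Prop. 3.6 = vectorwise uniform LDT).

Definitions (all with bodies):
* `andersonTransfer E α = !![E - α, -1; 1, 0]` (Def. 2.2), `det = 1`;
* `andersonTransferProd E α n = M^E(α_{n-1}) ⋯ M^E(α_0)` for a sample `α : ℕ → ℝ` (§2:
  `M_n(ω) = M(T^{n-1}ω)⋯M(ω)` for `n > 0`, `M_0 = 𝕀`), finite samples `α : Fin n → ℝ` being padded
  by `padSeq`;
* `andersonLogNormAvg μ E n = n⁻¹ ∫ log ‖M_n^E‖ dμ^{⊗n}` and the **Lyapunov exponent**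
  `andersonLyapunov μ E = inf_{n ≥ 1} n⁻¹ ∫ log‖M_n^E‖ dμ^{⊗n}` (§2: `L = lim_n n⁻¹∫ log‖M_n‖ dμ
  = inf_{n≥1} n⁻¹∫ log‖M_n‖ dμ ≥ 0`; the norm is the Euclidean operator norm,
  `Matrix.Norms.L2Operator`);
* `andersonKappa μ = 2 + max_{α ∈ supp μ̃} |α|`, so that `Σ̂ = [-κ, κ]` (§3).

Named facts (D-0014; hypotheses exactly the standing ones of Def. 2.2: `𝒜 = supp μ̃ ⊂ ℝ`
compact, `#𝒜 ≥ 2`; events depending on `ω_0, …, ω_{n-1}` only are written on the `n`-fold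
product `μ̃^{⊗n}`):
* `BucajEtAl2019_lyapunovPos` — Thm 2.3: `L(E) > 0` for every `E ∈ ℝ`;
* `BucajEtAl2019_lyapunovContinuous` — Thm 2.6: `E ↦ L(E)` is continuous;
* `BucajEtAl2019_matrixLDT` — Thm 3.1: `∀ ε > 0 ∃ C, η > 0: μ{|n⁻¹ log‖M_n^E‖ - L(E)| ≥ ε} ≤ Ce^{-ηn}`
  for all `n ≥ 1`, `E ∈ Σ̂`;
* `BucajEtAl2019_vectorLDT` — Prop. 3.6: the same for `‖M_n^E v‖`, uniformly in the unit vector `v`.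

First consumer: the high-frequency bound (O'Connor's term) in the Ajanki–Huveneers scaling law
for the disordered harmonic chain (`Literature/Barriers/AtomisticToContinuum/`), whose transfer
matrices at frequency `ω` are `M^2(m_k ω²)`.
-/

noncomputable section

open MeasureTheory
open scoped Matrix.Norms.L2Operator

namespace Literature.Probability.RandomMatrixProducts

/-! ### Transfer matrices -/

/-- **The one-step transfer matrix** `M^E(α) = [[E - α, -1],[1, 0]] ∈ SL(2,ℝ)` of the Anderson
model at energy `E` and site potential `α`. [cite: BucajEtAl2019, Def. 2.2] -/
def andersonTransfer (E α : ℝ) : Matrix (Fin 2) (Fin 2) ℝ := !![E - α, -1; 1, 0]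

/-- Entry `(0,0)` of `M^E(α)` is `E - α`. [cite: BucajEtAl2019, Def. 2.2] -/
@[simp] theorem andersonTransfer_apply_00 (E α : ℝ) : andersonTransfer E α 0 0 = E - α := rfl
/-- Entry `(0,1)` of `M^E(α)` is `-1`. [cite: BucajEtAl2019, Def. 2.2] -/
@[simp] theorem andersonTransfer_apply_01 (E α : ℝ) : andersonTransfer E α 0 1 = -1 := rfl
/-- Entry `(1,0)` of `M^E(α)` is `1`. [cite: BucajEtAl2019, Def. 2.2] -/
@[simp] theorem andersonTransfer_apply_10 (E α : ℝ) : andersonTransfer E α 1 0 = 1 := rfl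
/-- Entry `(1,1)` of `M^E(α)` is `0`. [cite: BucajEtAl2019, Def. 2.2] -/
@[simp] theorem andersonTransfer_apply_11 (E α : ℝ) : andersonTransfer E α 1 1 = 0 := rfl

/-- `det M^E(α) = 1`. [cite: BucajEtAl2019, Def. 2.2] -/
@[simp] theorem det_andersonTransfer (E α : ℝ) : (andersonTransfer E α).det = 1 := by
  simp [andersonTransfer, Matrix.det_fin_two_of]

/-- Padding of a finite sample `α : Fin n → ℝ` to a sequence (by `0` beyond `n`). [folklore] -/
def padSeq {n : ℕ} (α : Fin n → ℝ) (k : ℕ) : ℝ := if h : k < n then α ⟨k, h⟩ else 0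

/-- Inside the sample the padding is the sample. [folklore] -/
theorem padSeq_of_lt {n : ℕ} (α : Fin n → ℝ) {k : ℕ} (hk : k < n) : padSeq α k = α ⟨k, hk⟩ :=
  dif_pos hk

/-- Beyond the sample the padding is `0`. [folklore] -/
theorem padSeq_of_le {n : ℕ} (α : Fin n → ℝ) {k : ℕ} (hk : n ≤ k) : padSeq α k = 0 :=
  dif_neg (Nat.not_lt.mpr hk)

/-- `padSeq α i = α i` for `i : Fin n`. [folklore] -/
@[simp] theorem padSeq_apply_val {n : ℕ} (α : Fin n → ℝ) (i : Fin n) : padSeq α i = α i := by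
  rw [padSeq_of_lt α i.isLt]

/-- **The `n`-step transfer matrix** `M_n^E = M^E(α_{n-1}) ⋯ M^E(α_0)` (`M_0 = 1`) of a sample
`α : ℕ → ℝ` of potentials. [cite: BucajEtAl2019, §2 (display after eq. (2.1))] -/
def andersonTransferProd (E : ℝ) (α : ℕ → ℝ) : ℕ → Matrix (Fin 2) (Fin 2) ℝ
  | 0 => 1
  | n + 1 => andersonTransfer E (α n) * andersonTransferProd E α n

/-- `M_0 = 𝕀`. [cite: BucajEtAl2019, §2 (display after eq. (2.1))] -/
@[simp] theorem andersonTransferProd_zero (E : ℝ) (α : ℕ → ℝ) : andersonTransferProd E α 0 = 1 :=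
  rfl

/-- `M_{n+1} = M^E(α_n) M_n`. [cite: BucajEtAl2019, §2 (display after eq. (2.1))] -/
theorem andersonTransferProd_succ (E : ℝ) (α : ℕ → ℝ) (n : ℕ) :
    andersonTransferProd E α (n + 1) = andersonTransfer E (α n) * andersonTransferProd E α n := rfl

/-- `det M_n^E = 1`. [cite: BucajEtAl2019, §2] -/
@[simp] theorem det_andersonTransferProd (E : ℝ) (α : ℕ → ℝ) :
    ∀ n, (andersonTransferProd E α n).det = 1
  | 0 => by simp
  | n + 1 => by rw [andersonTransferProd_succ, Matrix.det_mul, det_andersonTransfer,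
      det_andersonTransferProd E α n, one_mul]

/-- `M_n^E` depends on `α_0, …, α_{n-1}` only. [folklore] -/
theorem andersonTransferProd_congr (E : ℝ) {α β : ℕ → ℝ} :
    ∀ n, (∀ k, k < n → α k = β k) → andersonTransferProd E α n = andersonTransferProd E β n
  | 0, _ => rfl
  | n + 1, h => by
    rw [andersonTransferProd_succ, andersonTransferProd_succ, h n (Nat.lt_succ_self n),
      andersonTransferProd_congr E n fun k hk => h k (Nat.lt_succ_of_lt hk)]

/-- The entries of `M_n^E` are continuous functions of the finite sample. [folklore] -/
theorem continuous_andersonTransferProd (E : ℝ) {n : ℕ} :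
    ∀ k, Continuous fun α : Fin n → ℝ => andersonTransferProd E (padSeq α) k
  | 0 => by simpa using continuous_const
  | k + 1 => by
    simp only [andersonTransferProd_succ]
    refine Continuous.mul ?_ (continuous_andersonTransferProd E k)
    have hc : Continuous fun α : Fin n → ℝ => padSeq α k := by
      unfold padSeq
      split_ifs with h
      · exact continuous_apply _
      · exact continuous_const
    refine continuous_matrix fun i j => ?_
    fin_cases i <;> fin_cases j <;> simp [andersonTransfer] <;> fun_prop

/-! ### The Lyapunov exponent -/

/-- The finite-volume average `n⁻¹ ∫ log ‖M_n^E‖ dμ̃^{⊗n}` (Euclidean operator norm).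
[cite: BucajEtAl2019, §2 (definition of `L`)] -/
def andersonLogNormAvg (μ : Measure ℝ) (E : ℝ) (n : ℕ) : ℝ :=
  (1 / (n : ℝ)) * ∫ α, Real.log ‖andersonTransferProd E (padSeq α) n‖ ∂(Measure.pi fun _ : Fin n => μ)

/-- **The Lyapunov exponent** `L(E) = inf_{n ≥ 1} n⁻¹ ∫ log ‖M_n^E‖ dμ`
(`= lim_n n⁻¹ ∫ log ‖M_n^E‖ dμ`, the limit existing by subadditivity).
[cite: BucajEtAl2019, §2 (definition of `L`) and Def. 2.2 (`L(E) := L(ν_E)`)] -/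
def andersonLyapunov (μ : Measure ℝ) (E : ℝ) : ℝ := ⨅ n : ℕ, andersonLogNormAvg μ E (n + 1)

/-- `κ = 2 + max_{α ∈ 𝒜} |α|`, `𝒜 = supp μ̃`; `Σ̂ := [-κ, κ]` contains the almost-sure spectrum
`Σ = 𝒜 + [-2, 2]`. [cite: BucajEtAl2019, §3 (display before Thm 3.1)] -/
def andersonKappa (μ : Measure ℝ) : ℝ := 2 + sSup ((fun α : ℝ => |α|) '' μ.support)

/-- `κ ≥ 2`. [folklore] -/
theorem two_le_andersonKappa (μ : Measure ℝ) : 2 ≤ andersonKappa μ := by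
  have : 0 ≤ sSup ((fun α : ℝ => |α|) '' μ.support) := by
    apply Real.sSup_nonneg
    rintro _ ⟨x, -, rfl⟩
    exact abs_nonneg x
  unfold andersonKappa
  linarith

/-- The large-deviation event `{|n⁻¹ log ‖M_n^E v‖ - L(E)| ≥ ε}` for a unit vector `v`, as a set of
finite samples. [cite: BucajEtAl2019, Prop. 3.6] -/
def andersonVectorLDSet (μ : Measure ℝ) (E ε : ℝ) (n : ℕ) (v : EuclideanSpace ℝ (Fin 2)) :
    Set (Fin n → ℝ) :=
  {α | ε ≤ |(1 / (n : ℝ)) * Real.log ‖Matrix.toEuclideanLin (andersonTransferProd E (padSeq α) n) v‖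
    - andersonLyapunov μ E|}

/-- The large-deviation event `{|n⁻¹ log ‖M_n^E‖ - L(E)| ≥ ε}` as a set of finite samples.
[cite: BucajEtAl2019, Thm 3.1] -/
def andersonMatrixLDSet (μ : Measure ℝ) (E ε : ℝ) (n : ℕ) : Set (Fin n → ℝ) :=
  {α | ε ≤ |(1 / (n : ℝ)) * Real.log ‖andersonTransferProd E (padSeq α) n‖ - andersonLyapunov μ E|}

/-! ### The named facts -/

/-- **Fürstenberg positivity for the Anderson model** (Bucaj et al. Thm 2.3, from Fürstenberg's
theorem, Thm 2.1 there): if the single-site law `μ̃` has compact support `𝒜` with `#𝒜 ≥ 2`, then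
`G_{ν_E}` is non-compact and strongly irreducible and `L(E) > 0` for EVERY `E ∈ ℝ`.
[cite: BucajEtAl2019, Thm 2.3] -/
def BucajEtAl2019_lyapunovPos : Prop :=
  ∀ (μ : Measure ℝ) [IsProbabilityMeasure μ], IsCompact μ.support → μ.support.Nontrivial →
    ∀ E : ℝ, 0 < andersonLyapunov μ E

/-- **Continuity of the Lyapunov exponent** (Bucaj et al. Thm 2.6, from Fürstenberg–Kifer): under the
same standing hypothesis, `E ↦ L(E)` is continuous on `ℝ`. [cite: BucajEtAl2019, Thm 2.6] -/
def BucajEtAl2019_lyapunovContinuous : Prop :=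
  ∀ (μ : Measure ℝ) [IsProbabilityMeasure μ], IsCompact μ.support → μ.support.Nontrivial →
    Continuous (andersonLyapunov μ)

/-- **Uniform large-deviation theorem** (Bucaj et al. Thm 3.1): for any `ε > 0` there exist
`C = C(ε) > 0`, `η = η(ε) > 0` such that `μ{ω : |n⁻¹ log ‖M_n^E(ω)‖ - L(E)| ≥ ε} ≤ C e^{-ηn}` for all
`n ∈ ℤ₊` and all `E ∈ Σ̂ = [-κ, κ]`. [cite: BucajEtAl2019, Thm 3.1] -/
def BucajEtAl2019_matrixLDT : Prop :=
  ∀ (μ : Measure ℝ) [IsProbabilityMeasure μ], IsCompact μ.support → μ.support.Nontrivial →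
    ∀ ε : ℝ, 0 < ε → ∃ C η : ℝ, 0 < C ∧ 0 < η ∧ ∀ n : ℕ, 1 ≤ n →
      ∀ E ∈ Set.Icc (-andersonKappa μ) (andersonKappa μ),
        (Measure.pi fun _ : Fin n => μ) (andersonMatrixLDSet μ E ε n) ≤
          ENNReal.ofReal (C * Real.exp (-(η * n)))

/-- **Vectorwise uniform large-deviation theorem** (Bucaj et al. Prop. 3.6): for every `ε > 0` there
exist constants `C, η > 0` such that
`μ{ω : |n⁻¹ log ‖M_n^E(ω) v‖ - L(E)| ≥ ε} ≤ C e^{-ηn}` for every `n ∈ ℤ₊`, every unit vector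
`v ∈ 𝕊¹ ⊂ ℝ²` and every `E ∈ Σ̂ = [-κ, κ]`. [cite: BucajEtAl2019, Prop. 3.6] -/
def BucajEtAl2019_vectorLDT : Prop :=
  ∀ (μ : Measure ℝ) [IsProbabilityMeasure μ], IsCompact μ.support → μ.support.Nontrivial →
    ∀ ε : ℝ, 0 < ε → ∃ C η : ℝ, 0 < C ∧ 0 < η ∧ ∀ n : ℕ, 1 ≤ n →
      ∀ v : EuclideanSpace ℝ (Fin 2), ‖v‖ = 1 →
        ∀ E ∈ Set.Icc (-andersonKappa μ) (andersonKappa μ),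
          (Measure.pi fun _ : Fin n => μ) (andersonVectorLDSet μ E ε n v) ≤
            ENNReal.ofReal (C * Real.exp (-(η * n)))

end Literature.Probability.RandomMatrixProducts

end
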